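import Literature.MathematicalPhysics.QuantumLattice.TypeClassSidecarReaderTTPrimeColdRow
import Literature.MathematicalPhysics.QuantumLattice.HubbardTorusMarkovStairWindow
import Literature.MathematicalPhysics.QuantumLattice.HubbardTTPrimeThermalPressureBoxWords
import Literature.MathematicalPhysics.QuantumLattice.TypeClassSidecarReaderAllTori
import Literature.MathematicalPhysics.QuantumLattice.HubbardTTPrimeThermalPressureLimit
import HarnessLib

/-!
# Hot anchors as NUMBERS: a Markov (C1) cluster certificate bounds the canonical pressure `pressureTT'` from above,
# and hot ceilings compose with pressure floors into chord cells on a temperature range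

Topic `Literature/MathematicalPhysics/QuantumLattice` (namespace = path; family `hubbard`). The `T > 0` certificate family of
sr-mbsolver/hubbard-thermal has two kinds of pressure inputs on the canonical sector pressure of record
`p(β) = pressureTT' β t t' U n` (`HubbardTTPrimeThermalPressureLimit`): FLOORS `W ≤ p(β)` (C2 open-box Peierls sidecars, the
seam-dressed C3 floors `SeamDressed.le_pressureTT'_of_floorNode`, the β-staircase) and CEILINGS at a hot anchor `p(β_h) ≤ P` from
Markov / Poulin–Hastings (C1) certificates. So far the C1 readers (`…meanEnergy_hubbardTTPrime_le_of_cornerMarkovCertificate`,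
`…_of_stairMarkovCertificate`, `…_of_rectMarkovCertificateTT'`) went from the certificate STRAIGHT to an energy chord with a
zero-entropy cold input. This file decouples the two ends, so that every hot certificate combines with every cold floor BY NAME:

* §1 `ThermodynamicLimit.pressureTT'_le_of_cornerMarkovCertificate` (t′ = 0, any corner window `Λ ⊆ [0,ℓ)²`),
  `…_of_stairMarkovCertificate` (two-row staircases), `…_of_rectMarkovCertificateTT'` (genuine `t–t'` certificates on rectangles):
  a C1 certificate at `(β_h, μ)` with constant `c` gives **`pressureTT' β_h t t' U n ≤ c − β_h·μ·n`** — by the finite-torus Markov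
  bound `eventually_log_partitionFn_sectorHamiltonianTT'_le_of_clusterCertificate(TT')` along `L → ∞` and `pressureTT'_le_iff`.
* §2 `IsTorusLimitOfMixture.meanEnergy_hubbardTTPrime_le_chord_of_pressureCeiling_of_pressureFloor`: numbers `p(β_h) ≤ P`,
  `W ≤ p(β₁)`, `0 < β_h < β₁ ≤ β` ⇒ `e_Φ(ω) ≤ (P − W)/(β₁ − β_h)` for EVERY torus limit at `β` (convexity chord at `β₁`,
  `meanEnergy_le_of_hotCeiling_of_pressureFloor`, then monotonicity in `β`, `…le_of_forall_at_hotter_allTori`).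

Pure theorems; no definition, no named fact. [cite: PoulinHastings2011, eqs. (3)–(8)] [cite: Israel1979, Thm. I.2.4]
[cite: GustafsonSigal2003, §18.3 Theorem 18.10]

## Tree / Mathlib search

REUSED: `eventually_log_partitionFn_sectorHamiltonianTT'_le_of_clusterCertificate` (`HubbardTorusMarkovClusterPressureTorusLimit`),
`…_of_clusterCertificateTT'`, `relabel_translate_hubbardTorusTT'_sub_mu` (`HubbardTorusTTPrimeMarkovPressureClusterBound`),
`relabel_translate_gibbsDensity`, `trace_window_mul_windowAnnihilator`, `isHermitian_windowAnnihilator`, corner / stair / rectangle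
bookkeeping (`bondWeightSum_cornerBondWeight`, `siteWeightSum_cornerSiteWeight`, `siteWeightSum_mul_cornerSiteWeight`,
`diagBondWeightSum_cornerDiagBondWeight`, `stairCorner_mem_stairWindow`, `toLex_le_toLex_stairCorner`,
`stairCorner_sub_unitVec_mem_stairWindow`, `stairWindow_subset_halfOpenBox`, `rectCorner_mem_rectWindow`, `toLex_le_toLex_rectCorner`,
`rectWindow_subset_halfOpenBox_max`, `rectCorner_sub_unitVec_mem_rectWindow`, `rectCorner_sub_unitVec_sub_unitVec_mem_rectWindow`),
`ThermodynamicLimit.pressureTT'_le_iff`, `meanEnergy_le_of_hotCeiling_of_pressureFloor` (`HubbardTTPrimeThermalPressureBoxWords`),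
`IsTorusLimitOfMixture.meanEnergy_hubbardTTPrime_le_of_forall_at_hotter_allTori`.
`lean search 'pressureTT.*_le_of_.*MarkovCertificate|chord_of_pressureCeiling'`: nothing (2026-08-27).
-/

noncomputable section

namespace Literature.MathematicalPhysics.QuantumLattice

open Matrix Finset HubbardWave0 Literature.Probability.LatticeModels ThermodynamicLimit AndersonCluster
open _root_.Filter
open scoped _root_.Topology ComplexOrder BigOperators

/-! ### §1. Hot pressure CEILINGS as numbers from C1 certificates -/

namespace ThermodynamicLimit

section Ceiling

variable {t U n : ℝ}

/-- **C1 ⇒ hot ceiling on the number (t′ = 0, corner window).** A Markov cluster certificate on a window `Λ ⊆ [0, ℓ)²` with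
lexicographically largest site `a` and `a − e₀, a − e₁ ∈ Λ`, at `(β_h, μ)` (`β_h ≥ 0`) with annihilator terms inside `Λ`, a
Hermitian dual `L_B ∈ 𝔄_{Λ∖a}` and constant `c` such that `e^c·exp(L_B) − tr_a exp(−β_h (h_μ + G) + Γ L_B) ⪰ 0`
(`h_μ = cornerEnergyRep Λ a t U μ`), gives `pressureTT' β_h t 0 U n ≤ c − β_h μ n` (`U ≥ 0`, `0 ≤ n < 2`).
[cite: PoulinHastings2011, eqs. (3)–(8)] [cite: Israel1979, Thm. I.2.4] -/
theorem pressureTT'_le_of_cornerMarkovCertificate (hU : 0 ≤ U) (hn0 : 0 ≤ n) (hn2 : n < 2)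
    {βh : ℝ} (hβh : 0 ≤ βh) (μ : ℝ) {Λ : Finset (Site 2)} {a : Site 2} (ha : a ∈ Λ)
    (hmax : ∀ y ∈ Λ, toLex y ≤ toLex a) (hcorner : ∀ i : Fin 2, a - unitVec i ∈ Λ) {ℓw : ℕ} (hΛ : Λ ⊆ halfOpenBox 2 ℓw)
    {ι : Type*} (s : Finset ι) (S : ι → Finset (Site 2)) (hS : ∀ i, S i ⊆ Λ) (z : ι → Site 2)
    (hz : ∀ i, shiftSet (z i) (S i) ⊆ Λ) {O : ∀ i, FermionOp (S i)} (hO : ∀ i ∈ s, (O i).IsHermitian) (g : ι → ℝ)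
    {LB : FermionOp (Λ.erase a)} (hLB : LB.IsHermitian) {c : ℝ}
    (hcert : ((Real.exp c : ℂ) • cfc Real.exp LB -
      fermionPartialTrace (PolySite.incl (Finset.erase_subset a Λ))
        (cfc Real.exp (-((βh : ℂ) • (cornerEnergyRep Λ a t U μ + windowAnnihilator s Λ S hS z hz O g)) +
          fermionEmbed (PolySite.incl (Finset.erase_subset a Λ)) LB))).PosSemidef) :
    pressureTT' βh t 0 U n ≤ c - βh * μ * n := by
  rw [pressureTT'_le_iff hβh t 0 hU hn0 hn2]
  intro ε hε
  have h := eventually_log_partitionFn_sectorHamiltonianTT'_le_of_clusterCertificate t U μ βh hn0 hn2.le tendsto_id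
    ha hmax hΛ (fun i => bondWeightSum_cornerBondWeight ha (hcorner i)) (siteWeightSum_cornerSiteWeight ha)
    (siteWeightSum_mul_cornerSiteWeight ha (-μ)) (isHermitian_windowAnnihilator s _ S hS z hz hO g)
    (fun L _ hL3 hℓL => trace_window_mul_windowAnnihilator
      (relabel_translate_gibbsDensity L (relabel_translate_hubbardTorusTT'_sub_mu (L := L) t 0 U μ) βh)
      _ s S hS z hz O g) hLB hcert hε
  filter_upwards [h] with L hL
  exact hL

/-- **C1 ⇒ hot ceiling on the number (two-row staircase).** Same, on `Λ = stairWindow lo₁ hi₁ lo₀ hi₀` (`lo₁ + 2 ≤ hi₁`,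
`lo₀ + 1 ≤ hi₁ ≤ hi₀`, corner `(1, hi₁ − 1)`): `pressureTT' β_h t 0 U n ≤ c − β_h μ n`.
[cite: PoulinHastings2011, eqs. (3)–(8)] [cite: Israel1979, Thm. I.2.4] -/
theorem pressureTT'_le_of_stairMarkovCertificate (hU : 0 ≤ U) (hn0 : 0 ≤ n) (hn2 : n < 2)
    {βh : ℝ} (hβh : 0 ≤ βh) (μ : ℝ) {lo₁ hi₁ lo₀ hi₀ : ℕ} (h₁ : lo₁ + 2 ≤ hi₁) (h₀ : lo₀ + 1 ≤ hi₁) (h₀' : hi₁ ≤ hi₀)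
    {ι : Type*} (s : Finset ι) (S : ι → Finset (Site 2)) (hS : ∀ i, S i ⊆ stairWindow lo₁ hi₁ lo₀ hi₀)
    (z : ι → Site 2) (hz : ∀ i, shiftSet (z i) (S i) ⊆ stairWindow lo₁ hi₁ lo₀ hi₀) {O : ∀ i, FermionOp (S i)}
    (hO : ∀ i ∈ s, (O i).IsHermitian) (g : ι → ℝ)
    {LB : FermionOp ((stairWindow lo₁ hi₁ lo₀ hi₀).erase (mkSite2 1 (hi₁ - 1)))} (hLB : LB.IsHermitian) {c : ℝ}
    (hcert : ((Real.exp c : ℂ) • cfc Real.exp LB -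
      fermionPartialTrace (PolySite.incl (Finset.erase_subset (mkSite2 1 (hi₁ - 1)) (stairWindow lo₁ hi₁ lo₀ hi₀)))
        (cfc Real.exp (-((βh : ℂ) • (cornerEnergyRep (stairWindow lo₁ hi₁ lo₀ hi₀) (mkSite2 1 (hi₁ - 1)) t U μ +
            windowAnnihilator s (stairWindow lo₁ hi₁ lo₀ hi₀) S hS z hz O g)) +
          fermionEmbed (PolySite.incl (Finset.erase_subset (mkSite2 1 (hi₁ - 1)) (stairWindow lo₁ hi₁ lo₀ hi₀))) LB))).PosSemidef) :
    pressureTT' βh t 0 U n ≤ c - βh * μ * n :=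
  pressureTT'_le_of_cornerMarkovCertificate hU hn0 hn2 hβh μ (stairCorner_mem_stairWindow (by omega))
    toLex_le_toLex_stairCorner (stairCorner_sub_unitVec_mem_stairWindow h₁ h₀ h₀')
    (stairWindow_subset_halfOpenBox lo₁ hi₁ lo₀ hi₀) s S hS z hz hO g hLB hcert

/-- **Genuine `t–t'` C1 ⇒ hot ceiling on the number (rectangle).** A `t–t'` Markov certificate on `rectWindow a' b'`
(`a', b' ≥ 2`, corner `(a' − 1, b' − 1)`, representative `cornerEnergyRepTT'`) at `(β_h, μ)` with constant `c` gives
`pressureTT' β_h t t' U n ≤ c − β_h μ n`. [cite: PoulinHastings2011, eqs. (3)–(8)] [cite: Israel1979, Thm. I.2.4] -/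
theorem pressureTT'_le_of_rectMarkovCertificateTT' {t' : ℝ} (hU : 0 ≤ U) (hn0 : 0 ≤ n) (hn2 : n < 2)
    {βh : ℝ} (hβh : 0 ≤ βh) (μ : ℝ) {a' b' : ℕ} (ha' : 2 ≤ a') (hb' : 2 ≤ b')
    {ι : Type*} (sι : Finset ι) (Sw : ι → Finset (Site 2)) (hS : ∀ i, Sw i ⊆ rectWindow a' b') (zw : ι → Site 2)
    (hzw : ∀ i, shiftSet (zw i) (Sw i) ⊆ rectWindow a' b') {O : ∀ i, FermionOp (Sw i)}
    (hO : ∀ i ∈ sι, (O i).IsHermitian) (g : ι → ℝ)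
    {LB : FermionOp ((rectWindow a' b').erase (mkSite2 (a' - 1) (b' - 1)))} (hLB : LB.IsHermitian) {c : ℝ}
    (hcert : ((Real.exp c : ℂ) • cfc Real.exp LB -
      fermionPartialTrace (PolySite.incl (Finset.erase_subset (mkSite2 (a' - 1) (b' - 1)) (rectWindow a' b')))
        (cfc Real.exp (-((βh : ℂ) • (cornerEnergyRepTT' (rectWindow a' b') (mkSite2 (a' - 1) (b' - 1)) t t' U μ +
            windowAnnihilator sι (rectWindow a' b') Sw hS zw hzw O g)) +
          fermionEmbed (PolySite.incl (Finset.erase_subset (mkSite2 (a' - 1) (b' - 1)) (rectWindow a' b'))) LB))).PosSemidef) :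
    pressureTT' βh t t' U n ≤ c - βh * μ * n := by
  have hAc := rectCorner_mem_rectWindow (a := a') (b := b') (by omega) (by omega)
  rw [pressureTT'_le_iff hβh t t' hU hn0 hn2]
  intro ε hε
  have h := eventually_log_partitionFn_sectorHamiltonianTT'_le_of_clusterCertificateTT' t t' U μ βh hn0 hn2.le tendsto_id
    hAc toLex_le_toLex_rectCorner (rectWindow_subset_halfOpenBox_max a' b')
    (fun i => bondWeightSum_cornerBondWeight hAc (rectCorner_sub_unitVec_mem_rectWindow ha' hb' i))
    (diagBondWeightSum_cornerDiagBondWeight hAc (rectCorner_sub_unitVec_mem_rectWindow ha' hb' 0)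
      (rectCorner_sub_unitVec_mem_rectWindow ha' hb' 1)
      (InfVolFermionState.rectCorner_sub_unitVec_sub_unitVec_mem_rectWindow ha' hb'))
    (siteWeightSum_cornerSiteWeight hAc) (siteWeightSum_mul_cornerSiteWeight hAc (-μ))
    (isHermitian_windowAnnihilator sι _ Sw hS zw hzw hO g)
    (fun L _ hL3 hℓL => trace_window_mul_windowAnnihilator
      (relabel_translate_gibbsDensity L (relabel_translate_hubbardTorusTT'_sub_mu (L := L) t t' U μ) βh)
      _ sι Sw hS zw hzw O g) hLB hcert hε
  filter_upwards [h] with L hL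
  exact hL

end Ceiling

end ThermodynamicLimit

/-! ### §2. Chord cells on a temperature range from a hot ceiling number and a cold floor number -/

namespace InfVolFermionState

variable {t t' U n : ℝ}

/-- **Range chord from numbers.** `p(β_h) ≤ P` (hot anchor), `W ≤ p(β₁)` (cold floor), `0 < β_h < β₁ ≤ β`, `U ≥ 0`,
`0 ≤ n < 2`: every torus limit `ω` of the canonical sector Gibbs states at `β` has `e_Φ(ω) ≤ (P − W)/(β₁ − β_h)` (the convexity
chord at `β₁`, then `e` non-increasing in `β`). [cite: Israel1979, Lemma II.3.1] -/
theorem IsTorusLimitOfMixture.meanEnergy_hubbardTTPrime_le_chord_of_pressureCeiling_of_pressureFloor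
    (hU : 0 ≤ U) (hn0 : 0 ≤ n) (hn2 : n < 2) {βh β₁ β P W : ℝ} (hβh : 0 < βh) (hlt : βh < β₁) (hle : β₁ ≤ β)
    (hP : pressureTT' βh t t' U n ≤ P) (hW : W ≤ pressureTT' β₁ t t' U n)
    {ω : InfVolFermionState 2} {Ls : ℕ → ℕ} (hLs : Tendsto Ls atTop atTop)
    (h : ω.IsTorusLimitOfMixture (sectorGibbsCount n) (fun L => sectorGibbsWeightTT' β t t' U n L)
      (fun L => sectorGibbsVectorTT' t t' U n L) Ls) :
    ω.meanEnergy (hubbardTTPrimeFermionInteraction t t' U) 1 ≤ (P - W) / (β₁ - βh) :=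
  IsTorusLimitOfMixture.meanEnergy_hubbardTTPrime_le_of_forall_at_hotter_allTori hn0 hn2.le (hβh.trans hlt) hle
    (fun ω₁ Ls₁ hLs₁ h₁ => meanEnergy_le_of_hotCeiling_of_pressureFloor hn0 hn2 t t' hU hβh hlt hP hW ω₁ Ls₁ hLs₁ h₁) hLs h

end InfVolFermionState

/-! ### §3. Append (hubbard-thermal-p1 g7, 2026-08-27T21:15Z): the `t′ = 0` rectangle wrapper -/

namespace ThermodynamicLimit

/-- **C1 ⇒ hot ceiling on the number (t′ = 0 rectangle).** A Markov certificate on `rectWindow a' b'` (`a', b' ≥ 2`, corner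
`(a' − 1, b' − 1)`, representative `cornerEnergyRep`) at `(β_h, μ)` with constant `c` gives `pressureTT' β_h t 0 U n ≤ c − β_h μ n` —
the shape of hubbard-thermal-eng-2's `3 × 2` C1 claim nodes `cert_feC1_3x2_…` (`rectWindow 2 3`, corner `mkSite2 1 2`).
[cite: PoulinHastings2011, eqs. (3)–(8)] [cite: Israel1979, Thm. I.2.4] -/
theorem pressureTT'_le_of_rectMarkovCertificate {t U n : ℝ} (hU : 0 ≤ U) (hn0 : 0 ≤ n) (hn2 : n < 2)
    {βh : ℝ} (hβh : 0 ≤ βh) (μ : ℝ) {a' b' : ℕ} (ha' : 2 ≤ a') (hb' : 2 ≤ b')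
    {ι : Type*} (sι : Finset ι) (Sw : ι → Finset (Site 2)) (hS : ∀ i, Sw i ⊆ rectWindow a' b') (zw : ι → Site 2)
    (hzw : ∀ i, shiftSet (zw i) (Sw i) ⊆ rectWindow a' b') {O : ∀ i, FermionOp (Sw i)}
    (hO : ∀ i ∈ sι, (O i).IsHermitian) (g : ι → ℝ)
    {LB : FermionOp ((rectWindow a' b').erase (mkSite2 (a' - 1) (b' - 1)))} (hLB : LB.IsHermitian) {c : ℝ}
    (hcert : ((Real.exp c : ℂ) • cfc Real.exp LB -
      fermionPartialTrace (PolySite.incl (Finset.erase_subset (mkSite2 (a' - 1) (b' - 1)) (rectWindow a' b')))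
        (cfc Real.exp (-((βh : ℂ) • (cornerEnergyRep (rectWindow a' b') (mkSite2 (a' - 1) (b' - 1)) t U μ +
            windowAnnihilator sι (rectWindow a' b') Sw hS zw hzw O g)) +
          fermionEmbed (PolySite.incl (Finset.erase_subset (mkSite2 (a' - 1) (b' - 1)) (rectWindow a' b'))) LB))).PosSemidef) :
    pressureTT' βh t 0 U n ≤ c - βh * μ * n :=
  pressureTT'_le_of_cornerMarkovCertificate hU hn0 hn2 hβh μ (rectCorner_mem_rectWindow (a := a') (b := b') (by omega) (by omega))
    toLex_le_toLex_rectCorner (rectCorner_sub_unitVec_mem_rectWindow ha' hb') (rectWindow_subset_halfOpenBox_max a' b')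
    sι Sw hS zw hzw hO g hLB hcert

end ThermodynamicLimit

/-! ### §3 (appended 2026-08-28). The mirror image: energy FLOORS on a temperature range from a floor number and a COLDER ceiling number -/

namespace InfVolFermionState

/-- **Range cold chord from numbers (thermal LOWER edge).** `W ≤ p(β₁)` (floor at `β₁`), `p(β_c) ≤ P` (ceiling at a COLDER
`β_c > β₁`), `0 < β ≤ β₁`, `U ≥ 0`, `0 ≤ n < 2`: every torus limit `ω` of the canonical sector Gibbs states at `β` (i.e. at every
temperature `T ≥ 1/β₁`) has `(W − P)/(β_c − β₁) ≤ e_Φ(ω)` — the convexity chord of the pressure between `β₁` and `β_c`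
(`le_meanEnergy_of_pressureFloor_of_coldCeiling` at `β₁`), then `e` non-increasing in `β` across torus limits
(`…le_meanEnergy_hubbardTTPrime_of_forall_at_colder_allTori`). With the hot anchors of §1 as the ceilings `P` this is the kernel form
of the lower edges of hubbard-thermal-eng-2's two-sided energy windows at hot cells. [cite: Israel1979, Lemma II.3.1] -/
theorem IsTorusLimitOfMixture.chord_le_meanEnergy_hubbardTTPrime_of_pressureFloor_of_pressureCeiling {t t' U n : ℝ}
    (hU : 0 ≤ U) (hn0 : 0 ≤ n) (hn2 : n < 2) {β β₁ βc W P : ℝ} (hβ : 0 < β) (hle : β ≤ β₁) (hlt : β₁ < βc)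
    (hW : W ≤ pressureTT' β₁ t t' U n) (hP : pressureTT' βc t t' U n ≤ P)
    {ω : InfVolFermionState 2} {Ls : ℕ → ℕ} (hLs : Tendsto Ls atTop atTop)
    (h : ω.IsTorusLimitOfMixture (sectorGibbsCount n) (fun L => sectorGibbsWeightTT' β t t' U n L)
      (fun L => sectorGibbsVectorTT' t t' U n L) Ls) :
    (W - P) / (βc - β₁) ≤ ω.meanEnergy (hubbardTTPrimeFermionInteraction t t' U) 1 :=
  IsTorusLimitOfMixture.le_meanEnergy_hubbardTTPrime_of_forall_at_colder_allTori hn0 hn2.le hβ hle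
    (fun ω₁ Ls₁ hLs₁ h₁ => le_meanEnergy_of_pressureFloor_of_coldCeiling hn0 hn2 t t' hU (lt_of_lt_of_le hβ hle) hlt hW hP
      ω₁ Ls₁ hLs₁ h₁) hLs h

/-- **Two-sided range window from three numbers**: a hot ceiling `p(β_h) ≤ P_h`, a floor `W ≤ p(β₁)` and a cold ceiling
`p(β_c) ≤ P_c` with `0 < β_h < β₁ < β_c` give, for every torus limit AT `β = β₁`,
`(W − P_c)/(β_c − β₁) ≤ e_Φ(ω) ≤ (P_h − W)/(β₁ − β_h)`. [cite: Israel1979, Lemma II.3.1] -/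
theorem IsTorusLimitOfMixture.meanEnergy_hubbardTTPrime_mem_Icc_of_ceilings_of_pressureFloor {t t' U n : ℝ}
    (hU : 0 ≤ U) (hn0 : 0 ≤ n) (hn2 : n < 2) {βh β₁ βc W Ph Pc : ℝ} (hβh : 0 < βh) (hlt₁ : βh < β₁) (hlt₂ : β₁ < βc)
    (hPh : pressureTT' βh t t' U n ≤ Ph) (hW : W ≤ pressureTT' β₁ t t' U n) (hPc : pressureTT' βc t t' U n ≤ Pc)
    {ω : InfVolFermionState 2} {Ls : ℕ → ℕ} (hLs : Tendsto Ls atTop atTop)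
    (h : ω.IsTorusLimitOfMixture (sectorGibbsCount n) (fun L => sectorGibbsWeightTT' β₁ t t' U n L)
      (fun L => sectorGibbsVectorTT' t t' U n L) Ls) :
    (W - Pc) / (βc - β₁) ≤ ω.meanEnergy (hubbardTTPrimeFermionInteraction t t' U) 1 ∧
      ω.meanEnergy (hubbardTTPrimeFermionInteraction t t' U) 1 ≤ (Ph - W) / (β₁ - βh) :=
  ⟨IsTorusLimitOfMixture.chord_le_meanEnergy_hubbardTTPrime_of_pressureFloor_of_pressureCeiling hU hn0 hn2
      (hβh.trans hlt₁) le_rfl hlt₂ hW hPc hLs h,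
    IsTorusLimitOfMixture.meanEnergy_hubbardTTPrime_le_chord_of_pressureCeiling_of_pressureFloor hU hn0 hn2 hβh hlt₁ le_rfl
      hPh hW hLs h⟩

end InfVolFermionState

/-! ### §4 (appended 2026-08-28). COLD RAYS FROM NUMBERS: a hot ceiling number and a `T = 0` energy CAP give the energy cap
`(P + β·q)/(β − β_h)` at every `β > β_h` (the zero-entropy pressure floor `−β·q ≤ p(β)` as the cold end) -/

namespace ThermodynamicLimit

/-- **Zero-entropy pressure floor from a ground-state energy cap**: `e(t,t',U,n) ≤ q` and `β ≥ 0` give `−β·q ≤ p(β; t,t',U; n)`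
(`−β·e ≤ p(β)` is the entropy-free half of `pressureTT'_mem_Icc`). With a CERTIFIED `T = 0` upper row as `q` this is the cold input
of every Peierls–Bogoliubov / Markov cold ray. [cite: Ruelle1969, §3.3] [cite: Israel1979, Thm. I.2.4] -/
theorem neg_mul_le_pressureTT'_of_energyCap {β : ℝ} (hβ : 0 ≤ β) (t t' : ℝ) {U : ℝ} (hU : 0 ≤ U) {n : ℝ} (hn0 : 0 ≤ n)
    (hn2 : n < 2) {q : ℝ} (hq : energyDensityTT' t t' U n ≤ q) :
    -(β * q) ≤ pressureTT' β t t' U n := by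
  have hp := (pressureTT'_mem_Icc hβ t t' hU hn0 hn2).1
  nlinarith

end ThermodynamicLimit

namespace InfVolFermionState

/-- **Cold ray from numbers.** `p(β_h) ≤ P` (hot ceiling), `e(t,t',U,n) ≤ q` (`T = 0` cap), `0 < β_h < β`, `U ≥ 0`, `0 ≤ n < 2`:
every torus limit `ω` of the canonical sector Gibbs states at `β` has `e_Φ(ω) ≤ (P + β·q)/(β − β_h)` — the convexity chord between the
hot anchor and the zero-entropy floor `−β·q ≤ p(β)` at the state's own `β` (`meanEnergy_le_of_hotCeiling_of_pressureFloor`). As a function of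
`β` this is the COLD RAY: decreasing when `P + β_h·q ≥ 0`, tending to `q` as `β → ∞`; affine in `q` with slope `β/(β − β_h)` (the cap-table lever).
[cite: Israel1979, Lemma II.3.1] [cite: Ruelle1969, §3.3] -/
theorem IsTorusLimitOfMixture.meanEnergy_hubbardTTPrime_le_coldRay_of_pressureCeiling_of_energyCap {t t' U n : ℝ}
    (hU : 0 ≤ U) (hn0 : 0 ≤ n) (hn2 : n < 2) {βh β P q : ℝ} (hβh : 0 < βh) (hlt : βh < β)
    (hP : pressureTT' βh t t' U n ≤ P) (hq : energyDensityTT' t t' U n ≤ q)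
    {ω : InfVolFermionState 2} {Ls : ℕ → ℕ} (hLs : Tendsto Ls atTop atTop)
    (h : ω.IsTorusLimitOfMixture (sectorGibbsCount n) (fun L => sectorGibbsWeightTT' β t t' U n L)
      (fun L => sectorGibbsVectorTT' t t' U n L) Ls) :
    ω.meanEnergy (hubbardTTPrimeFermionInteraction t t' U) 1 ≤ (P + β * q) / (β - βh) := by
  have hW := ThermodynamicLimit.neg_mul_le_pressureTT'_of_energyCap (le_of_lt (hβh.trans hlt)) t t' hU hn0 hn2 hq
  have hm := meanEnergy_le_of_hotCeiling_of_pressureFloor hn0 hn2 t t' hU hβh hlt hP hW ω Ls hLs h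
  refine hm.trans (le_of_eq ?_)
  ring

/-- **Cold ray as a temperature-RANGE cap**: with `0 ≤ P + β_h·q` (the ray is non-increasing in `β`) and `β_h < β₁ ≤ β`, every torus limit at
`β` has `e_Φ(ω) ≤ (P + β₁·q)/(β₁ − β_h)` — the tabulated cell at `β₁` holds on the whole range `T ≤ 1/β₁` (`markovChordBound_anti`).
[cite: Israel1979, Lemma II.3.1] -/
theorem IsTorusLimitOfMixture.meanEnergy_hubbardTTPrime_le_coldRay_at_of_le {t t' U n : ℝ}
    (hU : 0 ≤ U) (hn0 : 0 ≤ n) (hn2 : n < 2) {βh β₁ β P q : ℝ} (hβh : 0 < βh) (hlt : βh < β₁) (hle : β₁ ≤ β)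
    (hA : 0 ≤ P + βh * q) (hP : pressureTT' βh t t' U n ≤ P) (hq : energyDensityTT' t t' U n ≤ q)
    {ω : InfVolFermionState 2} {Ls : ℕ → ℕ} (hLs : Tendsto Ls atTop atTop)
    (h : ω.IsTorusLimitOfMixture (sectorGibbsCount n) (fun L => sectorGibbsWeightTT' β t t' U n L)
      (fun L => sectorGibbsVectorTT' t t' U n L) Ls) :
    ω.meanEnergy (hubbardTTPrimeFermionInteraction t t' U) 1 ≤ (P + β₁ * q) / (β₁ - βh) :=
  (IsTorusLimitOfMixture.meanEnergy_hubbardTTPrime_le_coldRay_of_pressureCeiling_of_energyCap hU hn0 hn2 hβh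
      (lt_of_lt_of_le hlt hle) hP hq hLs h).trans (markovChordBound_anti hA hlt hle)

end InfVolFermionState

/-! ### §5 (appended 2026-08-28, hubbard-thermal-p4). COLD CEILINGS FROM NUMBERS: a hot ceiling number and a `T = 0` energy FLOOR give the
pressure ceiling `P − (β − β_h)·q` at every `β ≥ β_h` — the mirror of §4, and the ceiling direction of a two-sided free-energy window at a cold `β`
(D-0154 (1) «thermal certificates», conjunct K3: `f(β) = −p(β)/β ∈ [−(P − (β − β_h) q)/β, −W/β]` from a floor `W ≤ p(β)`, a hot anchor `p(β_h) ≤ P`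
and a ground-state lower row `q ≤ e(t,t',U,n)`) -/

namespace ThermodynamicLimit

/-- **Cold ceiling step with the ground-state energy**: for `0 ≤ b₀ ≤ b₁` (`U ≥ 0`, `0 ≤ n < 2`),
`p(b₁) ≤ p(b₀) − (b₁ − b₀)·e(t,t',U,n)` — the one-step ceiling staircase `pressureTT'_le_pressureTT'_sub_mul` with the thermal energy
floor `e(t,t',U,n) ≤ e_Φ(ω)` valid in EVERY torus limit of the canonical sector Gibbs states (`…energyDensityTT'_le_meanEnergy_of_sectorGibbs`,
the variational principle); equivalently the supporting-line bound of the convex `β ↦ p(β)` whose slope never exceeds `−e₀`.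
[cite: GustafsonSigal2003, §18.3] [cite: Ruelle1969, §3.3] -/
theorem pressureTT'_le_pressureTT'_sub_mul_energyDensityTT' (t t' : ℝ) {U : ℝ} (hU : 0 ≤ U) {n : ℝ} (hn0 : 0 ≤ n)
    (hn2 : n < 2) {b₀ b₁ : ℝ} (hb₀ : 0 ≤ b₀) (hb : b₀ ≤ b₁) :
    pressureTT' b₁ t t' U n ≤ pressureTT' b₀ t t' U n - (b₁ - b₀) * energyDensityTT' t t' U n :=
  pressureTT'_le_pressureTT'_sub_mul hn0 hn2 t t' hU hb₀ hb fun _ω _Ls hLs h =>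
    h.energyDensityTT'_le_meanEnergy_of_sectorGibbs t t' U hn0 hn2 b₁ hLs t' hU

/-- **Cold ceiling from numbers.** `p(β_h) ≤ P` (a hot ceiling, e.g. a §1 Markov anchor), `q ≤ e(t,t',U,n)` (a `T = 0` LOWER row),
`0 ≤ β_h ≤ β`: `p(β) ≤ P − (β − β_h)·q`. As a function of `β` this is the COLD CEILING RAY from the anchor with slope `−q = |q|`; divided by
`−β` it is the floor `−(P − (β − β_h) q)/β ≤ f(β)` on the free energy per site. [cite: GustafsonSigal2003, §18.3] [cite: Ruelle1969, §3.3] -/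
theorem pressureTT'_le_of_pressureCeiling_of_energyFloor (t t' : ℝ) {U : ℝ} (hU : 0 ≤ U) {n : ℝ} (hn0 : 0 ≤ n)
    (hn2 : n < 2) {βh β P q : ℝ} (hβh : 0 ≤ βh) (hle : βh ≤ β) (hP : pressureTT' βh t t' U n ≤ P)
    (hq : q ≤ energyDensityTT' t t' U n) :
    pressureTT' β t t' U n ≤ P - (β - βh) * q := by
  have h := pressureTT'_le_pressureTT'_sub_mul_energyDensityTT' t t' hU hn0 hn2 hβh hle
  have hβ : 0 ≤ β - βh := sub_nonneg.2 hle
  nlinarith [mul_le_mul_of_nonneg_left hq hβ]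

/-- **Certificate-free cold ceiling**: the infinite-temperature anchor `p(0) = 2 H_b(n/2)` and a `T = 0` lower row `q ≤ e(t,t',U,n)` give
`p(β) ≤ 2 H_b(n/2) − β·q` for every `β ≥ 0` (the a-priori window `pressureTT'_mem_Icc` re-priced at `q`). [cite: Ruelle1969, §3.3] -/
theorem pressureTT'_le_two_mul_binEntropy_sub_mul_of_energyFloor (t t' : ℝ) {U : ℝ} (hU : 0 ≤ U) {n : ℝ} (hn0 : 0 ≤ n)
    (hn2 : n < 2) {β q : ℝ} (hβ : 0 ≤ β) (hq : q ≤ energyDensityTT' t t' U n) :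
    pressureTT' β t t' U n ≤ 2 * Real.binEntropy (n / 2) - β * q := by
  have h := (pressureTT'_mem_Icc hβ t t' hU hn0 hn2).2
  nlinarith [mul_le_mul_of_nonneg_left hq hβ]

/-- **Two-sided pressure window at a cold `β` from three numbers**: a floor `W ≤ p(β)`, a hot ceiling `p(β_h) ≤ P` (`0 ≤ β_h ≤ β`) and a
`T = 0` lower row `q ≤ e(t,t',U,n)` give `p(β) ∈ [W, P − (β − β_h) q]`; for `β > 0` the free energy per site `f(β) = −p(β)/β` lies in
`[−(P − (β − β_h) q)/β, −W/β]`, of width `(P − (β − β_h) q − W)/β`. [cite: GustafsonSigal2003, §18.3] [cite: Israel1979, Thm. I.2.4] -/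
theorem neg_pressureTT'_div_mem_Icc_of_floor_of_pressureCeiling_of_energyFloor (t t' : ℝ) {U : ℝ} (hU : 0 ≤ U) {n : ℝ}
    (hn0 : 0 ≤ n) (hn2 : n < 2) {βh β W P q : ℝ} (hβh : 0 ≤ βh) (hle : βh ≤ β) (hβ : 0 < β)
    (hW : W ≤ pressureTT' β t t' U n) (hP : pressureTT' βh t t' U n ≤ P) (hq : q ≤ energyDensityTT' t t' U n) :
    -(pressureTT' β t t' U n) / β ∈ Set.Icc (-(P - (β - βh) * q) / β) (-W / β) := by
  have hc := pressureTT'_le_of_pressureCeiling_of_energyFloor t t' hU hn0 hn2 hβh hle hP hq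
  constructor
  · exact div_le_div_of_nonneg_right (neg_le_neg hc) hβ.le
  · exact div_le_div_of_nonneg_right (neg_le_neg hW) hβ.le

end ThermodynamicLimit

/-! ### §6 (appended 2026-08-28, hubbard-thermal-eng-4). The genuine `t–t'` C1 reader on the two-row STAIRCASE window
(the cuprate-point twin of `pressureTT'_le_of_stairMarkovCertificate`; consumer: the `t′ = −1/4` staircase certificates of kit j300793,
node family `cert_feC1tt_stair221_tpm1o4_b<β>_…`, and the cold-ray intercept of the cuprate bracket rows) -/

namespace ThermodynamicLimit

section StairTT

variable {t U n : ℝ}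

/-- The corner's down-left diagonal neighbour `(1, hi₁ − 1) − e₀ − e₁ = (0, hi₁ − 2)` lies in the staircase as soon as the bottom row
starts at least two columns left of the corner (`lo₀ + 2 ≤ hi₁ ≤ hi₀`). [cite: PoulinHastings2011, eqs. (3)–(8)] -/
theorem stairCorner_sub_unitVec_sub_unitVec_mem_stairWindow {lo₁ hi₁ lo₀ hi₀ : ℕ} (h₀ : lo₀ + 2 ≤ hi₁) (h₀' : hi₁ ≤ hi₀) :
    mkSite2 1 (hi₁ - 1) - unitVec 0 - unitVec 1 ∈ stairWindow lo₁ hi₁ lo₀ hi₀ := by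
  rw [stairCorner_sub_unitVec_zero hi₁]
  have h : mkSite2 0 (hi₁ - 1) - unitVec (1 : Fin 2) = mkSite2 0 (hi₁ - 2) := by
    funext j
    fin_cases j
    · show ((0 : ℕ) : ℤ) - (Pi.single (1 : Fin 2) (1 : ℤ) : Site 2) 0 = ((0 : ℕ) : ℤ)
      simp
    · show ((hi₁ - 1 : ℕ) : ℤ) - (Pi.single (1 : Fin 2) (1 : ℤ) : Site 2) 1 = ((hi₁ - 2 : ℕ) : ℤ)
      simp
      omega
  rw [h]
  exact mkSite2_zero_mem_stairWindow (by omega) (by omega)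

/-- **Genuine `t–t'` C1 ⇒ hot ceiling on the number (two-row staircase).** A `t–t'` Markov cluster certificate on
`Λ = stairWindow lo₁ hi₁ lo₀ hi₀` (`lo₁ + 2 ≤ hi₁`, `lo₀ + 2 ≤ hi₁ ≤ hi₀`, corner `a = (1, hi₁ − 1)`; the bottom row contains `a − e₀` and
the diagonal partner `a − e₀ − e₁`, the top row `a − e₁`), with corner representative `cornerEnergyRepTT' Λ a t t' U μ` (left and down bonds of `a`
plus the two diagonal bonds of the corner plaquette), annihilator terms inside `Λ`, a Hermitian dual `L_B ∈ 𝔄_{Λ∖a}` and a constant `c` with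
`e^c·exp(L_B) − tr_a exp(−β_h (h_μ + G) + Γ L_B) ⪰ 0`, gives `pressureTT' β_h t t' U n ≤ c − β_h μ n` (`U ≥ 0`, `0 ≤ n < 2`).
Proof = the general window bound `eventually_log_partitionFn_sectorHamiltonianTT'_le_of_clusterCertificateTT'` with the staircase bookkeeping of
`HubbardTorusMarkovStairWindow` (corner lexicographically largest, unit bond / site weights, `diagBondWeightSum_cornerDiagBondWeight` on the corner block).
[cite: PoulinHastings2011, eqs. (3)–(8)] [cite: Israel1979, Thm. I.2.4] -/
theorem pressureTT'_le_of_stairMarkovCertificateTT' {t' : ℝ} (hU : 0 ≤ U) (hn0 : 0 ≤ n) (hn2 : n < 2)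
    {βh : ℝ} (hβh : 0 ≤ βh) (μ : ℝ) {lo₁ hi₁ lo₀ hi₀ : ℕ} (h₁ : lo₁ + 2 ≤ hi₁) (h₀ : lo₀ + 2 ≤ hi₁) (h₀' : hi₁ ≤ hi₀)
    {ι : Type*} (sι : Finset ι) (Sw : ι → Finset (Site 2)) (hS : ∀ i, Sw i ⊆ stairWindow lo₁ hi₁ lo₀ hi₀) (zw : ι → Site 2)
    (hzw : ∀ i, shiftSet (zw i) (Sw i) ⊆ stairWindow lo₁ hi₁ lo₀ hi₀) {O : ∀ i, FermionOp (Sw i)}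
    (hO : ∀ i ∈ sι, (O i).IsHermitian) (g : ι → ℝ)
    {LB : FermionOp ((stairWindow lo₁ hi₁ lo₀ hi₀).erase (mkSite2 1 (hi₁ - 1)))} (hLB : LB.IsHermitian) {c : ℝ}
    (hcert : ((Real.exp c : ℂ) • cfc Real.exp LB -
      fermionPartialTrace (PolySite.incl (Finset.erase_subset (mkSite2 1 (hi₁ - 1)) (stairWindow lo₁ hi₁ lo₀ hi₀)))
        (cfc Real.exp (-((βh : ℂ) • (cornerEnergyRepTT' (stairWindow lo₁ hi₁ lo₀ hi₀) (mkSite2 1 (hi₁ - 1)) t t' U μ +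
            windowAnnihilator sι (stairWindow lo₁ hi₁ lo₀ hi₀) Sw hS zw hzw O g)) +
          fermionEmbed (PolySite.incl (Finset.erase_subset (mkSite2 1 (hi₁ - 1)) (stairWindow lo₁ hi₁ lo₀ hi₀))) LB))).PosSemidef) :
    pressureTT' βh t t' U n ≤ c - βh * μ * n := by
  have hAc : mkSite2 1 (hi₁ - 1) ∈ stairWindow lo₁ hi₁ lo₀ hi₀ := stairCorner_mem_stairWindow (by omega)
  have hbond := stairCorner_sub_unitVec_mem_stairWindow (lo₀ := lo₀) (hi₀ := hi₀) h₁ (by omega) h₀'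
  rw [pressureTT'_le_iff hβh t t' hU hn0 hn2]
  intro ε hε
  have h := eventually_log_partitionFn_sectorHamiltonianTT'_le_of_clusterCertificateTT' t t' U μ βh hn0 hn2.le tendsto_id
    hAc toLex_le_toLex_stairCorner (stairWindow_subset_halfOpenBox lo₁ hi₁ lo₀ hi₀)
    (fun i => bondWeightSum_cornerBondWeight hAc (hbond i))
    (diagBondWeightSum_cornerDiagBondWeight hAc (hbond 0) (hbond 1)
      (stairCorner_sub_unitVec_sub_unitVec_mem_stairWindow h₀ h₀'))
    (siteWeightSum_cornerSiteWeight hAc) (siteWeightSum_mul_cornerSiteWeight hAc (-μ))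
    (isHermitian_windowAnnihilator sι _ Sw hS zw hzw hO g)
    (fun L _ hL3 hℓL => trace_window_mul_windowAnnihilator
      (relabel_translate_gibbsDensity L (relabel_translate_hubbardTorusTT'_sub_mu (L := L) t t' U μ) βh)
      _ sι Sw hS zw hzw O g) hLB hcert hε
  filter_upwards [h] with L hL
  exact hL

end StairTT

end ThermodynamicLimit

end Literature.MathematicalPhysics.QuantumLattice

end
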